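import Summits.HodgeConjecture.CorCM.QuarticCMConjugationSquare
import Literature.NumberTheory.ComplexMultiplication.QuarticCMTypes
import Literature.NumberTheory.ComplexMultiplication.CMTypeRankCommonConstituent
import HarnessLib

/-!
# The mixed dihedral pair, I: the swap–reflection `g = τσ₀` and the irreducibility of `U(Ψ)` for a non-Galois quartic
# CM field

COR-CM (cell `pub-hodgecm2`, seat p2 gen 18, count-neutral claim CLOSURE-BOUND (F4a)); NEW as stated, hence under
`Summits/`.  Theorems only; no definition, no named fact, no `sorry`.  Consumed by `DihedralReflexPairCMHodge` (F4b: the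
pair of simple CM abelian surfaces with non-isomorphic quartic CM fields sharing their Galois closure is nondegenerate).

THE SITUATION (Shimura, *Abelian Varieties with CM*, §8.4 Example (2)(C); Moonen–Zarhin 1999, "Hodge groups of simple
abelian surfaces of CM-type").  Let `K` be a quartic CM field which is NOT Galois over `ℚ`; its Galois closure `L ⊂ ℂ` is a
dihedral octic CM field (`QuarticCMTypes.finrank_normalClosure_eq_eight_of_not_isGalois`), containing up to conjugacy
exactly two non-Galois quartic CM fields: `K` and the reflex field `M = K* = ℚ(ξ + ξ^φ)`.  Here `M` is ANY quartic
(CM) field with `Hom(M, ℂ)` landing in `L` and `Hom(M, K) = ∅`.  On `Hom(K, ℂ) = {a, ā, b, b̄}` one has Shimura's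
`4`-cycle `τ` (`τa = b`, `τb = ā`; the tree's `QuarticCM.exists_ringAut_smul_eq_smul_eq_conjugate`) and the reflection
`σ₀` (`σ₀a = a`, `σ₀b = b̄`; `QuarticCM.exists_ringAut_smul_eq_self_smul_eq_conjugate_of_not_isGalois`).  In the dihedral
group of the square, `σ₀` is a reflection through a vertex; on the EDGES (= `Hom(M, ℂ)`) it fixes nothing, while the
axis reflection `g = τσ₀`, which SWAPS the vertices `a, b`, fixes an edge.

WHAT IS PROVED (namespace `DihedralReflexPair`).
* §1 `forall_smul_eq_of_pair`, `smul_eq_smul_of_forall_smul_eq` — automorphisms of `ℂ` agreeing on `a, b` agree on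
  every embedding of `M`.
* §2 **`smul_eq_self_of_smul_eq_self`** — an automorphism fixing `a` and ONE embedding `t` of `M` fixes `b`: the field
  `a(K)·t(M) ⊆ L` has degree in `4ℕ ∩ {divisors of 8} ∖ {4}` (`= 4` would give `t(M) ⊆ a(K)`, `M ↪ K`:
  `nonempty_ringHom_of_forall_mem_range`), so it is `L ∋ b(y)`; `finrank_normalClosure_eq_eight`.
* §3 **`exists_swap_reflect`** — `g ∈ Aut(ℂ)` and `t₁ ∉ {t₀, t̄₀}` in `Hom(M, ℂ)` with `g a = b`, `g b = a`, `g t₀ = t₀`,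
  `g t₁ = t̄₁` (`g = τσ₀`, `{t₀, t₁} = {t, σ₀t}`).
* §4 **`antiSpan_eq_of_stable`** — for a non-Galois quartic CM field `M` and any CM type `Ψ`, Shimura's antisymmetric span
  `U(Ψ) ⊆ ℚ^{Hom(M, ℂ)}` has no `Aut(ℂ)`-stable subspace other than `0` and itself (a stable line would be an eigenline of
  the `4`-cycle: `f(t′) = c f(t)`, `−f(t) = f(t̄) = c² f(t)`).

## References

* [Shimura1998] G. Shimura, *Abelian Varieties with Complex Multiplication and Modular Functions*, §8.4 Example (2)(C).
* [MoonenZarhin1999LowDim] B. Moonen, Yu. Zarhin, *Hodge classes on abelian varieties of low dimension*, Math. Ann. 315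
  (1999) 711–733, "Hodge groups of simple abelian surfaces of CM-type".
-/

noncomputable section

open NumberField NumberField.ComplexEmbedding IntermediateField

namespace Summit.HodgeConjecture.CorCM

open Literature.NumberTheory.ComplexMultiplication
open Literature.AlgebraicGeometry.Motives (CMType)
open Literature.AlgebraicGeometry.Pohlmann1968
open QuarticCM

namespace DihedralReflexPair

/-! ### §1 Transfer from `Hom(K, ℂ)` to `Hom(M, ℂ)` -/

section TwoFields

variable {K M : Type} [Field K] [NumberField K] [IsCMField K] [Field M] [NumberField M] [IsCMField M]

/-- Two automorphisms of `ℂ` that agree on the embeddings `a` and `b` (`b ∉ {a, ā}`) of a quartic CM field agree on all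
four embeddings `a, ā, b, b̄`. [cite: Shimura1998, §8.4 Example (2)(C)] -/
theorem forall_smul_eq_of_pair (h4 : Module.finrank ℚ K = 4) {a b : K →+* ℂ} (hba : b ≠ a) (hba' : b ≠ conjugate a)
    {γ γ' : ℂ ≃+* ℂ} (ha : γ • a = γ' • a) (hb : γ • b = γ' • b) : ∀ s : K →+* ℂ, γ • s = γ' • s := by
  intro s
  rcases eq_or_eq_or_eq_or_eq h4 hba hba' s with rfl | rfl | rfl | rfl
  · exact ha
  · rw [smul_conjugate, smul_conjugate, ha]
  · exact hb
  · rw [smul_conjugate, smul_conjugate, hb]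

omit [IsCMField K] [NumberField M] [IsCMField M] in
/-- **Transfer.**  If every complex embedding of `M` takes values in the Galois closure `L` of `K` in `ℂ`, two
automorphisms of `ℂ` that agree on every embedding of `K` (hence on `L`) agree on every embedding of `M`.
[cite: Shimura1998, §8.4 Example (2)(C)] -/
theorem smul_eq_smul_of_forall_smul_eq (hMK : ∀ (t : M →+* ℂ) (y : M), t y ∈ normalClosure ℚ K ℂ)
    {γ γ' : ℂ ≃+* ℂ} (hK : ∀ s : K →+* ℂ, γ • s = γ' • s) (t : M →+* ℂ) : γ • t = γ' • t := by
  have h1 : ∀ s : K →+* ℂ, (γ'⁻¹ * γ) • s = s := fun s => by rw [mul_smul, hK s, inv_smul_smul]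
  refine RingHom.ext fun y => ?_
  have h2 : (γ'⁻¹ * γ) (t y) = t y := apply_eq_self_of_mem_normalClosure h1 (hMK t y)
  have h3 : γ' (γ'⁻¹ (γ (t y))) = γ' (t y) := congrArg γ' h2
  rw [show γ'⁻¹ = γ'.symm from rfl, γ'.apply_symm_apply] at h3
  exact h3

/-! ### §2 An automorphism fixing `a` and one embedding of `M` fixes everything -/

omit [IsCMField K] [IsCMField M] in
/-- If `t(M) ⊆ a(K)` then `M` embeds into `K` (compose `t` with the inverse of `a` on its image). [folklore] -/
theorem nonempty_ringHom_of_forall_mem_range {a : K →+* ℂ} {t : M →+* ℂ} (h : ∀ y, t y ∈ Set.range a) :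
    Nonempty (M →+* K) := by
  choose f hf using h
  refine ⟨{ toFun := f, map_one' := ?_, map_mul' := ?_, map_zero' := ?_, map_add' := ?_ }⟩
  · exact a.injective (by rw [hf, map_one, map_one])
  · intro y z; exact a.injective (by rw [hf, map_mul, map_mul, hf, hf])
  · exact a.injective (by rw [hf, map_zero, map_zero])
  · intro y z; exact a.injective (by rw [hf, map_add, map_add, hf, hf])

omit [IsCMField K] in
/-- `[a(K) : ℚ] = [K : ℚ]` for the image of a complex embedding, as an intermediate field of `ℂ/ℚ`. [folklore] -/
private theorem finrank_fieldRange_toRatAlgHom (a : K →+* ℂ) :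
    Module.finrank ℚ a.toRatAlgHom.fieldRange = Module.finrank ℚ K := by
  rw [← IntermediateField.finrank_eq_finrank_subalgebra, AlgHom.fieldRange_toSubalgebra]
  exact (AlgEquiv.ofInjectiveField a.toRatAlgHom).toLinearEquiv.finrank_eq.symm

/-- The Galois closure in `ℂ` of a non-Galois quartic CM field has degree `8` (octic dihedral; `QuarticCMTypes` §9 read
for `normalClosure ℚ K ℂ`). [cite: Shimura1998, §8.4 Example (2)(C)] -/
theorem finrank_normalClosure_eq_eight (h4 : Module.finrank ℚ K = 4) (hK : ¬IsGalois ℚ K) :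
    Module.finrank ℚ ↥(normalClosure ℚ K ℂ) = 8 := by
  haveI : IsNormalClosure ℚ K ↥(normalClosure ℚ K ℂ) :=
    Algebra.IsAlgebraic.isNormalClosure_normalClosure fun x => IsAlgClosed.splits _
  haveI : NumberField ↥(normalClosure ℚ K ℂ) :=
    { to_charZero := inferInstance, to_finiteDimensional := inferInstance }
  exact finrank_normalClosure_eq_eight_of_not_isGalois (K := K) (L := ↥(normalClosure ℚ K ℂ)) h4 hK

omit [IsCMField M] in
/-- **An automorphism of `ℂ` fixing the embedding `a` of `K` and ONE embedding `t` of `M` fixes `b` too** — provided `M`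
does not embed into `K` and `Hom(M, ℂ)` lands in the Galois closure `L` of `K`: the field `a(K)·t(M) ⊆ L` has degree a
multiple of `4` dividing `8` and is not `a(K)` (else `t(M) ⊆ a(K)`, `M ↪ K`), so it is all of `L ∋ b(y)`.  (In the
dihedral group: a reflection fixing a vertex fixes no edge.) [cite: Shimura1998, §8.4 Example (2)(C)] -/
theorem smul_eq_self_of_smul_eq_self (h4K : Module.finrank ℚ K = 4) (hK : ¬IsGalois ℚ K)
    (hMK : ∀ (t : M →+* ℂ) (y : M), t y ∈ normalClosure ℚ K ℂ)
    (hne : IsEmpty (M →+* K)) {a b : K →+* ℂ} {γ : ℂ ≃+* ℂ} (ha : γ • a = a) {t : M →+* ℂ} (ht : γ • t = t) :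
    γ • b = b := by
  -- the fields `a(K)`, `t(M)`, their compositum `N`, the Galois closure `L`
  set La : IntermediateField ℚ ℂ := a.toRatAlgHom.fieldRange with hLa
  set Lt : IntermediateField ℚ ℂ := t.toRatAlgHom.fieldRange with hLt
  set L : IntermediateField ℚ ℂ := normalClosure ℚ K ℂ with hL
  have hLaL : La ≤ L := a.toRatAlgHom.fieldRange_le_normalClosure
  have hLtL : Lt ≤ L := by
    rintro _ ⟨y, rfl⟩
    exact hMK t y
  have hNL : La ⊔ Lt ≤ L := sup_le hLaL hLtL
  haveI : FiniteDimensional ℚ ↥(La ⊔ Lt) :=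
    FiniteDimensional.of_injective (IntermediateField.inclusion hNL).toLinearMap (IntermediateField.inclusion_injective hNL)
  have hLa4 : Module.finrank ℚ La = 4 := by rw [hLa, finrank_fieldRange_toRatAlgHom, h4K]
  have hL8 : Module.finrank ℚ L = 8 := finrank_normalClosure_eq_eight h4K hK
  -- `4 ∣ [N : ℚ] ∣ 8`
  have h4dvd : 4 ∣ Module.finrank ℚ ↥(La ⊔ Lt) := by
    rw [← hLa4]
    exact Dvd.intro _ (IntermediateField.finrank_bot_mul_relfinrank (le_sup_left : La ≤ La ⊔ Lt))
  have hdvd8 : Module.finrank ℚ ↥(La ⊔ Lt) ∣ 8 := by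
    rw [← hL8]
    exact Dvd.intro _ (IntermediateField.finrank_bot_mul_relfinrank hNL)
  -- `[N : ℚ] ≠ 4`: otherwise `t(M) ⊆ a(K)` and `M ↪ K`
  have hN4 : Module.finrank ℚ ↥(La ⊔ Lt) ≠ 4 := by
    intro h4N
    have hEq : La = La ⊔ Lt := IntermediateField.eq_of_le_of_finrank_eq le_sup_left (by rw [hLa4, h4N])
    have hsub : Lt ≤ La := by rw [hEq]; exact le_sup_right
    refine hne.false (Classical.choice (nonempty_ringHom_of_forall_mem_range (a := a) (t := t) fun y => ?_))
    have : t y ∈ La := hsub ⟨y, rfl⟩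
    obtain ⟨x, hx⟩ := this
    exact ⟨x, hx⟩
  -- hence `[N : ℚ] = 8` and `N = L`
  have hN8 : Module.finrank ℚ ↥(La ⊔ Lt) = 8 := by
    obtain ⟨k, hk⟩ := h4dvd
    have hk' : 4 * k ∣ 8 := hk ▸ hdvd8
    have hk2 : k ∣ 2 := by
      obtain ⟨m, hm⟩ := hk'
      refine ⟨m, (Nat.eq_of_mul_eq_mul_left (show 0 < 4 by norm_num) ?_).symm⟩
      rw [← mul_assoc, ← hm]
    rcases (Nat.dvd_prime Nat.prime_two).1 hk2 with rfl | rfl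
    · exact absurd hk (by rw [mul_one]; exact hN4)
    · rw [hk]
  have hNeq : La ⊔ Lt = L := IntermediateField.eq_of_le_of_finrank_eq hNL (by rw [hN8, hL8])
  -- `γ` fixes `N = L` pointwise
  let φ : ℂ →ₐ[ℚ] ℂ := (AlgEquiv.ofRingEquiv (f := γ) fun q => by simp).toAlgHom
  let D : IntermediateField ℚ ℂ :=
    ⟨AlgHom.equalizer φ (AlgHom.id ℚ ℂ), fun y (hy : γ y = y) => show γ y⁻¹ = y⁻¹ by rw [map_inv₀, hy]⟩
  have hLaD : La ≤ D := by
    rintro _ ⟨x, rfl⟩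
    exact RingHom.congr_fun ha x
  have hLtD : Lt ≤ D := by
    rintro _ ⟨y, rfl⟩
    exact RingHom.congr_fun ht y
  have hLD : L ≤ D := hNeq ▸ sup_le hLaD hLtD
  refine RingHom.ext fun y => ?_
  exact hLD (b.toRatAlgHom.fieldRange_le_normalClosure ⟨y, rfl⟩)

/-! ### §3 The swap–reflection `g = τσ₀` -/

/-- **The swap–reflection.**  For a non-Galois quartic CM field `K` with embeddings `b ∉ {a, ā}` and a quartic CM field
`M` with `Hom(M, ℂ)` landing in the Galois closure of `K` and `Hom(M, K) = ∅`, there are `g ∈ Aut(ℂ)` and embeddings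
`t₁ ∉ {t₀, t̄₀}` of `M` with `g ∘ a = b`, `g ∘ b = a`, `g ∘ t₀ = t₀`, `g ∘ t₁ = t̄₁`: `g = τσ₀` with Shimura's `4`-cycle `τ`
(`(a b ā b̄)`) and reflection `σ₀` (`a ↦ a`, `b ↦ b̄`); `{t₀, t₁} = {t, σ₀t}` for any embedding `t` of `M` — `σ₀` and `ρσ₀`
fix `a` resp. `b`, hence move every embedding of `M` (§2), so `σ₀ t ∉ {t, t̄}`; and `τ² = ρ`, `σ₀² = 1` on the closure.
In the dihedral group of the square: the reflection through a vertex `a` is, on the EDGES, an axis reflection.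
[cite: Shimura1998, §8.4 Example (2)(C)] -/
theorem exists_swap_reflect (h4K : Module.finrank ℚ K = 4) (hK : ¬IsGalois ℚ K) (h4M : Module.finrank ℚ M = 4)
    (hMK : ∀ (t : M →+* ℂ) (y : M), t y ∈ normalClosure ℚ K ℂ) (hne : IsEmpty (M →+* K))
    {a b : K →+* ℂ} (hba : b ≠ a) (hba' : b ≠ conjugate a) :
    ∃ (g : ℂ ≃+* ℂ) (t₀ t₁ : M →+* ℂ), t₁ ≠ t₀ ∧ t₁ ≠ conjugate t₀ ∧
      g • a = b ∧ g • b = a ∧ g • t₀ = t₀ ∧ g • t₁ = conjugate t₁ := by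
  have hab : a ≠ b := hba.symm
  have hab' : a ≠ conjugate b := fun h => hba' (by rw [h, involutive_conjugate])
  obtain ⟨τ, hτa, hτb⟩ := exists_ringAut_smul_eq_smul_eq_conjugate h4K hK hba hba'
  obtain ⟨σ₀, hσa, hσb⟩ := exists_ringAut_smul_eq_self_smul_eq_conjugate_of_not_isGalois h4K hK hba hba'
  obtain ⟨t⟩ : Nonempty (M →+* ℂ) := inferInstance
  -- `g = τσ₀` swaps `a` and `b`
  have hga : (τ * σ₀) • a = b := by rw [mul_smul, hσa, hτa]
  have hgb : (τ * σ₀) • b = a := by rw [mul_smul, hσb, smul_conjugate, hτb, involutive_conjugate]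
  -- `σ₀ t ∉ {t, t̄}`
  have hσt : σ₀ • t ≠ t := fun h =>
    conjugate_ne b ((smul_eq_self_of_smul_eq_self h4K hK hMK hne hσa h).symm.trans hσb).symm
  have hσt' : σ₀ • t ≠ conjugate t := by
    intro h
    have h1 : ((starRingAut : ℂ ≃+* ℂ) * σ₀) • b = b := by
      rw [mul_smul, hσb, conj_smul_eq_conjugate, involutive_conjugate]
    have h2 : ((starRingAut : ℂ ≃+* ℂ) * σ₀) • t = t := by
      rw [mul_smul, h, conj_smul_eq_conjugate, involutive_conjugate]
    have h3 : ((starRingAut : ℂ ≃+* ℂ) * σ₀) • a = a :=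
      smul_eq_self_of_smul_eq_self (a := b) (b := a) h4K hK hMK hne h1 h2
    rw [mul_smul, hσa, conj_smul_eq_conjugate] at h3
    exact conjugate_ne a h3
  -- `τ² = ρ` and `σ₀² = 1` on `Hom(M, ℂ)`
  have hττ : τ • τ • t = conjugate t := by
    have hK2 : ∀ s : K →+* ℂ, (τ * τ) • s = (starRingAut : ℂ ≃+* ℂ) • s := by
      refine forall_smul_eq_of_pair h4K hba hba' ?_ ?_
      · rw [mul_smul, hτa, hτb, conj_smul_eq_conjugate]
      · rw [mul_smul, hτb, smul_conjugate, hτa, conj_smul_eq_conjugate]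
    have := smul_eq_smul_of_forall_smul_eq hMK hK2 t
    rwa [mul_smul, conj_smul_eq_conjugate] at this
  have hσσ : σ₀ • σ₀ • t = t := by
    have hK2 : ∀ s : K →+* ℂ, (σ₀ * σ₀) • s = (1 : ℂ ≃+* ℂ) • s := by
      refine forall_smul_eq_of_pair h4K hba hba' ?_ ?_
      · rw [mul_smul, hσa, hσa, one_smul]
      · rw [mul_smul, hσb, smul_conjugate, hσb, involutive_conjugate, one_smul]
    have := smul_eq_smul_of_forall_smul_eq hMK hK2 t
    rwa [mul_smul, one_smul] at this
  -- where does `τ` send `t`?  Not to `t, t̄` (`τ² = ρ`), so to `σ₀ t` or to its conjugate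
  rcases eq_or_eq_or_eq_or_eq h4M hσt hσt' (τ • t) with h | h | h | h
  · rw [h, h] at hττ
    exact absurd hττ.symm (conjugate_ne t)
  · rw [h, smul_conjugate, h, involutive_conjugate] at hττ
    exact absurd hττ.symm (conjugate_ne t)
  · -- `τ t = σ₀ t`: `g` fixes `σ₀ t` and conjugates `t`
    refine ⟨τ * σ₀, σ₀ • t, t, hσt.symm, fun h' => hσt' ?_, hga, hgb, ?_, ?_⟩
    · have h'' := congrArg conjugate h'
      rw [involutive_conjugate] at h''
      exact h''.symm
    · rw [mul_smul, hσσ, h]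
    · rw [mul_smul, ← h, hττ]
  · -- `τ t = \overline{σ₀ t}`: `g` fixes `t` and conjugates `σ₀ t`
    have hτt' : τ • σ₀ • t = t := by
      have h1 : τ • conjugate (σ₀ • t) = conjugate t := by rw [← h, hττ]
      rw [smul_conjugate] at h1
      have := congrArg conjugate h1
      rwa [involutive_conjugate, involutive_conjugate] at this
    refine ⟨τ * σ₀, t, σ₀ • t, hσt, hσt', hga, hgb, ?_, ?_⟩
    · rw [mul_smul, hτt']
    · rw [mul_smul, hσσ, h]

/-! ### §4 `U(Ψ)` is an irreducible `Aut(ℂ)`-module for a non-Galois quartic CM field -/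

/-- **No proper stable subspace.**  For a CM type `Ψ` of a NON-GALOIS quartic CM field `M`, every non-zero subspace
`W ≤ U(Ψ)` stable under `f ↦ f ∘ k` (`k ∈ Aut(ℂ)`) is all of `U(Ψ)`: `U(Ψ)` is the (`2`-dimensional, `Ψ` being
nondegenerate) space of `ρ`-antisymmetric weights, and a stable LINE `ℚf` would make `f` an eigenvector of the `4`-cycle
`τ` (`τ t = t′`, `τ t′ = t̄`): `f(t′) = c f(t)`, `−f(t) = f(t̄) = c f(t′) = c² f(t)`, so `f = 0`.
[cite: MoonenZarhin1999LowDim, "Hodge groups of simple abelian surfaces of CM-type"] -/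
theorem antiSpan_eq_of_stable (h4 : Module.finrank ℚ M = 4) (hM : ¬IsGalois ℚ M) (Ψ : CMType M)
    (W : Submodule ℚ ((M →+* ℂ) → ℚ)) (hW : W ≤ antiSpan (ℂ ≃+* ℂ) Ψ.1) (hne : W ≠ ⊥)
    (hst : ∀ (k : ℂ ≃+* ℂ) (f : (M →+* ℂ) → ℚ), f ∈ W → (fun y => f (k • y)) ∈ W) :
    W = antiSpan (ℂ ≃+* ℂ) Ψ.1 := by
  -- `dim U(Ψ) = 2`
  have hU2 : Module.finrank ℚ (antiSpan (ℂ ≃+* ℂ) Ψ.1) = 2 := by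
    have hnd := isNondegenerate_of_not_isGalois h4 hM Ψ
    rw [isNondegenerate_iff, cmTypeRank, h4] at hnd
    have h3 : typeRank (ℂ ≃+* ℂ) Ψ.1 = 3 := hnd
    have h2 := (isCMTypeWith_conj Ψ).typeRank_eq_finrank_antiSpan_add_one
    rw [h3] at h2
    exact (Nat.add_right_cancel (h2.symm.trans (by norm_num : (3 : ℕ) = 2 + 1)))
  have hWle : Module.finrank ℚ W ≤ 2 := hU2 ▸ Submodule.finrank_mono hW
  have hW0 : Module.finrank ℚ W ≠ 0 := fun h => hne (Submodule.finrank_eq_zero.1 h)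
  by_cases hW2 : Module.finrank ℚ W = 2
  · exact Submodule.eq_of_le_of_finrank_eq hW (by rw [hW2, hU2])
  -- a stable line: `W = ℚ f`
  exfalso
  have hW1 : Module.finrank ℚ W = 1 := by omega
  obtain ⟨v, hv0, hv⟩ := finrank_eq_one_iff'.1 hW1
  -- the `4`-cycle of `M`
  obtain ⟨t⟩ : Nonempty (M →+* ℂ) := inferInstance
  obtain ⟨t', ht', ht''⟩ := exists_ne_ne_conjugate h4 t
  obtain ⟨τ, hτt, hτt'⟩ := exists_ringAut_smul_eq_smul_eq_conjugate h4 hM ht' ht''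
  -- `f ∘ τ = c f`
  have hmem : (fun y => (v : (M →+* ℂ) → ℚ) (τ • y)) ∈ W := hst τ v v.2
  obtain ⟨c, hc⟩ := hv ⟨_, hmem⟩
  have hc' : ∀ y, c * (v : (M →+* ℂ) → ℚ) y = (v : (M →+* ℂ) → ℚ) (τ • y) := fun y => by
    have := congrArg (fun w : W => (w : (M →+* ℂ) → ℚ) y) hc
    simpa using this
  -- `f` is `ρ`-antisymmetric
  have hanti : ∀ y, (v : (M →+* ℂ) → ℚ) (conjugate y) = -(v : (M →+* ℂ) → ℚ) y := fun y => by
    rw [← conj_smul_eq_conjugate]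
    exact apply_rho_smul_of_mem_antiSpan (isCMTypeWith_conj Ψ) (hW v.2) y
  -- `f(t) = 0`, then `f = 0`
  have h1 : (v : (M →+* ℂ) → ℚ) t' = c * (v : (M →+* ℂ) → ℚ) t := by rw [hc' t, hτt]
  have h2 : (v : (M →+* ℂ) → ℚ) (conjugate t) = c * (v : (M →+* ℂ) → ℚ) t' := by rw [hc' t', hτt']
  have ht0 : (v : (M →+* ℂ) → ℚ) t = 0 := by
    rw [hanti, h1] at h2
    nlinarith [sq_nonneg c, sq_nonneg ((v : (M →+* ℂ) → ℚ) t), sq_nonneg (c * (v : (M →+* ℂ) → ℚ) t)]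
  apply hv0
  refine Subtype.ext (funext fun y => ?_)
  change (v : (M →+* ℂ) → ℚ) y = 0
  rcases eq_or_eq_or_eq_or_eq h4 ht' ht'' y with rfl | rfl | rfl | rfl
  · exact ht0
  · rw [hanti, ht0, neg_zero]
  · rw [h1, ht0, mul_zero]
  · rw [hanti, h1, ht0, mul_zero, neg_zero]

end TwoFields

end DihedralReflexPair

end Summit.HodgeConjecture.CorCM

end
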